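import Summits.BirchSwinnertonDyer.BirchSwinnertonDyer.Theorems.PrintCFramBottomClassIndexLawFiveLeCuspSeedCuspValueSquared
import Summits.BirchSwinnertonDyer.BirchSwinnertonDyer.Theorems.PrintCFramBottomClassIndexLawFiveLeCuspSeedThetaJacobi
import Summits.BirchSwinnertonDyer.BirchSwinnertonDyer.Theorems.PrintCFramBottomClassIndexLawFiveLeCuspSeedAbelResidue
import HarnessLib

set_option autoImplicit false

/-!
# Crux `PrintCFram.BottomClassIndexLawFiveLe` (stmt-BirchSwinnertonDyer-20372), line `eisenstein-resource-bdp-line` (registry v24/v25):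
# CUSP GLUE (β) part 3 — THE ANNOUNCED `R` AND THE VEHICLE'S VERBATIM SOCKET SHAPES
# (cell `bsd-print-cfram`, width seat `bsd-line-cfram-p1-w2` g13; THEOREMS ONLY, `--supports` 20372; Mathlib currency;
# BSD is not proved by any of this)

HONEST FRAMING. Bookkeeping only (casts, one `p`-adic valuation, one divisibility); no modular form, no elliptic curve, no BSD.
Sibling of `…CuspSeedCuspValueSquared.lean` (`exists_cuspUnit_sq_eq_of_sockets`: Lemma A ∘ (α) ∘ [(E4) = (E3)] ⊢ the
`hsq`/`hu`/`hu0` sockets of w8 g8's `CuspGlue.cuspConjunct_of_sq_eq`, for an abstract rational prefactor `a`). Here: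

* §1 THE ANNOUNCED PREFACTOR (w5 g6's FINAL (E3) spelling, STATUS 2026-08-29T05:02:22Z, `CuspSeed.tendsto_sub_mul_LSeries_ite_cut_cohenH`:
  `R = (−1)^{⌊k/2⌋}(k−1)!/2^{k−1}/π^k·(c₂·c₃·∏_{q∣m,q≠2}(q−1)/(2q))·L(𝟙_{⊥m}, 2k)·m^{(−1:ℂ)}`, `c₂ = ⅛|¼`, `c₃ = 1|⅔`): **`padicValRat_announcedPrefactor`** (`v_p(a) = 0` for `p ≥ 5`, `k ≤ p`, `p ∤ m`),
  `announcedPrefactor_ne_zero`, `announcedPrefactor_cast`, **`exists_cuspUnit_sq_eq_of_sockets_announced`**;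
* §2 ADAPTERS to the vehicle's verbatim socket shapes (w8 g8, STATUS 2026-08-29T04:45:20Z): `weight_cast_sub_half`
  (`((k+1:ℕ):ℤ) − ½ = k + ½`), `I_zpow_natCast_succ`, `not_dvd_sq_twentyfour_mul_sq` (`t = (24m²)²`), the `A`-scaling
  `sq_natCast_mul_eq_ratCast_of_sq_eq` (`(A·v)² = ((A²u)·C²:ℚ)`) / `padicValRat_natCast_sq_mul`, and
  **`exists_cuspUnit_sq_eq_of_vehicle_sockets`** (Λ as a `zpow`, `ℓ = Λ·√(2·(24m²)²)`, exponent `((k+1:ℕ):ℤ) − ½`, `R` announced);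
* §3 THE ANALYTIC HALF OF (iii) IN ONE CALL: **`exists_cuspUnit_sq_eq_of_limits`** / **`exists_cuspUnit_sq_eq_of_limits_announced`** —
  from Lemma A's LIMIT for the weight-`(k+1)` vehicle `F` (`y^{k+1}F(iy) → i^{k+1}v`), the factorisation `F(iy) = (Σ a(n)e^{−2πny})·θ_t(iy)`
  (`t = (24m²)²`), `LSeriesSummable a s` for `s > k+½`, and the (E3) LIMIT `(s−(k+½))·L(a,s) → R` — chaining w8 g8's (α)
  `tendsto_rpow_smul_tsum_of_eq_mul_thetaMul`, w5 g6's (E4) `CuspSeed.tendsto_sub_mul_LSeries_of_tendsto_rpow_smul_tsum` and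
  `tendsto_nhds_unique` into §1/§2 — ⊢ `∃ u ∈ ℚ^×, v_p(u) = 0 ∧ v² = ((u·C²:ℚ):ℂ)`.

[folklore]
-/

-- summit-side namespace `Summit.BirchSwinnertonDyer.BirchSwinnertonDyer.…` (single-conjunct summit, D-0017 layout)
set_option linter.dupNamespace false

namespace Summit.BirchSwinnertonDyer.BirchSwinnertonDyer.Theorems.PrintCFram.CuspGlue

open Complex Finset Real Filter Topology
open UpperHalfPlane hiding I
open Literature.NumberTheory.EllipticCurves.Tunnell1983 (thetaMul)
open scoped Nat

/-! ### §1. The announced (E3) prefactor -/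

/-- **The announced (E3) prefactor is a `p`-adic unit**: for a prime `p ≥ 5` with `k ≤ p` and `p ∤ m`,
`v_p((−1)^{⌊k/2⌋}·(k−1)!/2^{k−1} · c₂ · c₃ / m) = 0` (`c₂ = ⅛` if `2 ∣ m` else `¼`, `c₃ = 1` if `3 ∣ m` else `⅔`). [folklore] -/
theorem padicValRat_announcedPrefactor {p k m : ℕ} [hp : Fact p.Prime] (h5 : 5 ≤ p) (hkp : k ≤ p) (hm : ¬ p ∣ m) :
    padicValRat p ((-1) ^ (k / 2) * ((k - 1)! : ℚ) / 2 ^ (k - 1) * (if 2 ∣ m then 1 / 8 else 1 / 4) *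
        (if 3 ∣ m then 1 else 2 / 3) / m : ℚ) = 0 := by
  have hm0 : m ≠ 0 := fun h ↦ hm (h ▸ dvd_zero p)
  have hmq : (m : ℚ) ≠ 0 := by exact_mod_cast hm0
  have hp2 : ¬ p ∣ 2 := fun h ↦ by have := Nat.le_of_dvd (by norm_num) h; omega
  have hp3 : ¬ p ∣ 3 := fun h ↦ by have := Nat.le_of_dvd (by norm_num) h; omega
  have hp8 : ¬ p ∣ 8 := fun h ↦ hp2 (by
    have h' : p ∣ 2 ^ 3 := by simpa using h
    exact hp.out.dvd_of_dvd_pow h')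
  have hp4 : ¬ p ∣ 4 := fun h ↦ hp2 (by
    have h' : p ∣ 2 ^ 2 := by simpa using h
    exact hp.out.dvd_of_dvd_pow h')
  have hfac : ¬ p ∣ (k - 1)! := by
    rw [hp.out.dvd_factorial]; omega
  have vnat : ∀ {n : ℕ}, ¬ p ∣ n → padicValRat p (n : ℚ) = 0 := fun h ↦ by
    rw [padicValRat.of_nat, padicValNat.eq_zero_of_not_dvd h]; simp
  have v2 : padicValRat p (2 : ℚ) = 0 := by exact_mod_cast vnat hp2
  have v3 : padicValRat p (3 : ℚ) = 0 := by exact_mod_cast vnat hp3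
  have vc2 : padicValRat p ((if 2 ∣ m then 1 / 8 else 1 / 4 : ℚ)) = 0 := by
    split_ifs
    · rw [one_div, padicValRat.inv]; have := vnat hp8; push_cast at this; rw [this]; simp
    · rw [one_div, padicValRat.inv]; have := vnat hp4; push_cast at this; rw [this]; simp
  have vc3 : padicValRat p ((if 3 ∣ m then 1 else 2 / 3 : ℚ)) = 0 := by
    split_ifs
    · exact padicValRat.one
    · rw [padicValRat.div (by norm_num) (by norm_num), v2, v3]; simp
  have vm1 : padicValRat p (-1 : ℚ) = 0 := by rw [padicValRat.neg, padicValRat.one]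
  have hc2 : ((if 2 ∣ m then 1 / 8 else 1 / 4 : ℚ)) ≠ 0 := by split_ifs <;> norm_num
  have hc3 : ((if 3 ∣ m then 1 else 2 / 3 : ℚ)) ≠ 0 := by split_ifs <;> norm_num
  have hfq : ((k - 1)! : ℚ) ≠ 0 := by exact_mod_cast (Nat.factorial_pos _).ne'
  have hneg : ((-1 : ℚ) ^ (k / 2)) ≠ 0 := pow_ne_zero _ (by norm_num)
  have h2k : ((2 : ℚ) ^ (k - 1)) ≠ 0 := pow_ne_zero _ (by norm_num)
  have hA : ((-1 : ℚ) ^ (k / 2) * ((k - 1)! : ℚ)) ≠ 0 := mul_ne_zero hneg hfq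
  have hB : ((-1 : ℚ) ^ (k / 2) * ((k - 1)! : ℚ) / 2 ^ (k - 1)) ≠ 0 := div_ne_zero hA h2k
  have hC : ((-1 : ℚ) ^ (k / 2) * ((k - 1)! : ℚ) / 2 ^ (k - 1) * (if 2 ∣ m then 1 / 8 else 1 / 4)) ≠ 0 :=
    mul_ne_zero hB hc2
  have hD : ((-1 : ℚ) ^ (k / 2) * ((k - 1)! : ℚ) / 2 ^ (k - 1) * (if 2 ∣ m then 1 / 8 else 1 / 4) *
      (if 3 ∣ m then 1 else 2 / 3)) ≠ 0 := mul_ne_zero hC hc3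
  rw [padicValRat.div hD hmq, padicValRat.mul hC hc3, padicValRat.mul hB hc2, padicValRat.div hA h2k,
    padicValRat.mul hneg hfq]
  simp only [padicValRat.pow, vm1, vnat hfac, v2, vc2, vc3, vnat hm, mul_zero, add_zero, sub_zero]

/-- The announced prefactor is non-zero. [folklore] -/
theorem announcedPrefactor_ne_zero {k m : ℕ} (hm : m ≠ 0) :
    ((-1) ^ (k / 2) * ((k - 1)! : ℚ) / 2 ^ (k - 1) * (if 2 ∣ m then 1 / 8 else 1 / 4) *
        (if 3 ∣ m then 1 else 2 / 3) / m : ℚ) ≠ 0 := by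
  have hmq : (m : ℚ) ≠ 0 := by exact_mod_cast hm
  have hc2 : ((if 2 ∣ m then 1 / 8 else 1 / 4 : ℚ)) ≠ 0 := by split_ifs <;> norm_num
  have hc3 : ((if 3 ∣ m then 1 else 2 / 3 : ℚ)) ≠ 0 := by split_ifs <;> norm_num
  have hfq : ((k - 1)! : ℚ) ≠ 0 := by exact_mod_cast (Nat.factorial_pos _).ne'
  exact div_ne_zero (mul_ne_zero (mul_ne_zero (div_ne_zero (mul_ne_zero (pow_ne_zero _ (by norm_num)) hfq)
    (pow_ne_zero _ (by norm_num))) hc2) hc3) hmq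

/-- The announced (E3) prefactor, cast to `ℂ`, in w5 g6's spelling (STATUS 2026-08-29T04:36:14Z). [folklore] -/
theorem announcedPrefactor_cast (k m : ℕ) :
    ((((-1) ^ (k / 2) * ((k - 1)! : ℚ) / 2 ^ (k - 1) * (if 2 ∣ m then 1 / 8 else 1 / 4) *
        (if 3 ∣ m then 1 else 2 / 3) / m : ℚ)) : ℂ) =
      (-1 : ℂ) ^ (k / 2) * ((k - 1)! : ℂ) / 2 ^ (k - 1) * (if 2 ∣ m then 1 / 8 else 1 / 4) *
        (if 3 ∣ m then 1 else 2 / 3) * (m : ℂ)⁻¹ := by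
  split_ifs <;> push_cast <;> ring

/-- **PACKAGED, ANNOUNCED SPELLING.** The same as `exists_cuspUnit_sq_eq_of_sockets` with the (E4) = (E3) equation written with
w5 g6's FINAL `R = (−1)^{⌊k/2⌋}(k−1)!/2^{k−1} / π^k · (c₂·c₃·∏_{q∣m,q≠2}(q−1)/(2q)) · L(𝟙_{⊥m}, 2k) · m^{(−1:ℂ)}` VERBATIM
(`CuspSeed.tendsto_sub_mul_LSeries_ite_cut_cohenH`, STATUS 2026-08-29T05:02:22Z; the `cpow` is removed by `Complex.cpow_neg_one`), for a prime
`p ≥ 5` with `1 ≤ k ≤ p`, `p ∤ m`, `p ∤ t`: `∃ u ∈ ℚ^×, v_p(u) = 0 ∧ v² = ((u·C²:ℚ):ℂ)`. [folklore] -/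
theorem exists_cuspUnit_sq_eq_of_sockets_announced {p k m t : ℕ} [hp : Fact p.Prime] (h5 : 5 ≤ p) (hk : k ≠ 0)
    (hkp : k ≤ p) (hpm : ¬ p ∣ m) (hpt : ¬ p ∣ t) (ht : 0 < t) {v Λ ℓ : ℂ}
    (hΛ : Λ = I ^ (k + 1) * v) (hℓ : ℓ = Λ * (Real.sqrt (2 * t) : ℂ))
    (hE : (((2 * π) ^ ((k : ℝ) + 1 / 2) / Real.Gamma ((k : ℝ) + 1 / 2) : ℝ) : ℂ) * ℓ =
      (-1 : ℂ) ^ (k / 2) * ((k - 1)! : ℂ) / 2 ^ (k - 1) / (π : ℂ) ^ k *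
        ((if 2 ∣ m then 1 / 8 else 1 / 4) * (if 3 ∣ m then 1 else 2 / 3) *
          ∏ q ∈ m.primeFactors.erase 2, (((q : ℂ) - 1) / (2 * q))) *
        LSeries (fun N ↦ if N.Coprime m then (1 : ℂ) else 0) (2 * k) * (m : ℂ) ^ (-1 : ℂ)) :
    ∃ u : ℚ, u ≠ 0 ∧ padicValRat p u = 0 ∧
      v ^ 2 = ((u * (bernoulli (2 * k) / (k.factorial : ℚ) * (m : ℚ) ^ (k - 1) *
        ∏ q ∈ m.primeFactors, ((q : ℚ) - 1) * ((q : ℚ) ^ (2 * k) - 1) / (q : ℚ) ^ (2 * k + 1)) ^ 2 : ℚ) : ℂ) := by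
  have hm : m ≠ 0 := fun h ↦ hpm (h ▸ dvd_zero p)
  have hp2 : p ≠ 2 := by omega
  set a : ℚ := (-1) ^ (k / 2) * ((k - 1)! : ℚ) / 2 ^ (k - 1) * (if 2 ∣ m then 1 / 8 else 1 / 4) *
    (if 3 ∣ m then 1 else 2 / 3) / m with ha_def
  have hE' : (((2 * π) ^ ((k : ℝ) + 1 / 2) / Real.Gamma ((k : ℝ) + 1 / 2) : ℝ) : ℂ) * ℓ =
      ((a : ℂ) * ∏ q ∈ m.primeFactors.erase 2, (((q : ℂ) - 1) / (2 * q))) / (π : ℂ) ^ k *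
        LSeries (fun N ↦ if N.Coprime m then (1 : ℂ) else 0) (2 * k) := by
    rw [hE, Complex.cpow_neg_one, ha_def, announcedPrefactor_cast]
    ring
  exact exists_cuspUnit_sq_eq_of_sockets hp2 hk hpm hpt ht (announcedPrefactor_ne_zero hm)
    (padicValRat_announcedPrefactor h5 hkp hpm) hΛ hℓ hE'

/-! ### §2. Adapters to the vehicle's verbatim socket shapes (w8 g8, STATUS 2026-08-29T04:45:20Z) -/

/-- The (E4) exponent of the weight-`(k+1)` vehicle: `((k+1 : ℕ) : ℤ) − ½ = k + ½` in `ℝ`. [folklore] -/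
theorem weight_cast_sub_half (k : ℕ) : (((k + 1 : ℕ) : ℤ) : ℝ) - 1 / 2 = (k : ℝ) + 1 / 2 := by
  push_cast; ring

/-- `i^{((k+1 : ℕ) : ℤ)} = i^{k+1}` (Lemma A's `zpow` against the natural power). [folklore] -/
theorem I_zpow_natCast_succ (k : ℕ) : (I : ℂ) ^ ((k + 1 : ℕ) : ℤ) = I ^ (k + 1) := zpow_natCast _ _

/-- For a prime `p ≥ 5` with `p ∤ m`: `p ∤ (24·m²)²` (the vehicle's theta parameter `t = Q²`, `Q = 24m²`). [folklore] -/
theorem not_dvd_sq_twentyfour_mul_sq {p m : ℕ} (hp : p.Prime) (h5 : 5 ≤ p) (hpm : ¬ p ∣ m) :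
    ¬ p ∣ (24 * m ^ 2) ^ 2 := by
  intro h
  have h1 : p ∣ 24 * m ^ 2 := hp.dvd_of_dvd_pow h
  rcases (Nat.Prime.dvd_mul hp).mp h1 with h24 | hm2
  · have h24' : p ∣ 2 ^ 3 * 3 := by norm_num at h24 ⊢; exact h24
    rcases (Nat.Prime.dvd_mul hp).mp h24' with h8 | h3
    · have := Nat.le_of_dvd (by norm_num) (hp.dvd_of_dvd_pow h8); omega
    · have := Nat.le_of_dvd (by norm_num) h3; omega
  · exact hpm (hp.dvd_of_dvd_pow hm2)

/-- **The `A`-scaling of the end of the chain**: if `v² = u·C²` then `(A·v)² = (A²u)·C²` (NF-Q is applied to `A • F`, whose cusp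
value is `A·v`; w7 g6's denominator-clearing integer `A`, `p ∤ A`). [folklore] -/
theorem sq_natCast_mul_eq_ratCast_of_sq_eq {v : ℂ} {u C : ℚ} (A : ℕ) (hsq : v ^ 2 = ((u * C ^ 2 : ℚ) : ℂ)) :
    ((A : ℂ) * v) ^ 2 = ((((A : ℚ) ^ 2 * u) * C ^ 2 : ℚ) : ℂ) := by
  rw [mul_pow, hsq]; push_cast; ring

/-- `v_p(A²·u) = 0` and `A²·u ≠ 0` for `p ∤ A`, `A ≠ 0`, `v_p(u) = 0`, `u ≠ 0`. [folklore] -/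
theorem padicValRat_natCast_sq_mul {p A : ℕ} [hp : Fact p.Prime] (hA : ¬ p ∣ A) {u : ℚ} (hu0 : u ≠ 0)
    (hu : padicValRat p u = 0) : ((A : ℚ) ^ 2 * u) ≠ 0 ∧ padicValRat p ((A : ℚ) ^ 2 * u) = 0 := by
  have hA0 : A ≠ 0 := fun h ↦ hA (h ▸ dvd_zero p)
  have hAq : (A : ℚ) ≠ 0 := by exact_mod_cast hA0
  refine ⟨mul_ne_zero (pow_ne_zero _ hAq) hu0, ?_⟩
  rw [padicValRat.mul (pow_ne_zero _ hAq) hu0, padicValRat.pow, padicValRat.of_nat,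
    padicValNat.eq_zero_of_not_dvd hA, hu]
  simp

/-- **PACKAGED, VEHICLE SHAPES.** The `hsq`/`hu`/`hu0` sockets of `CuspGlue.cuspConjunct_of_sq_eq` from the vehicle's own limit
shapes: Lemma A's `Λ = i^{((k+1:ℕ):ℤ)}·v`, (α)'s `ℓ = Λ·√(2·(24m²)²)`, and the (E4) = (E3) equation at the exponent
`((k+1:ℕ):ℤ) − ½` with `R` in the announced spelling; for a prime `p ≥ 5`, `1 ≤ k ≤ p`, `p ∤ m`. [folklore] -/
theorem exists_cuspUnit_sq_eq_of_vehicle_sockets {p k m : ℕ} [hp : Fact p.Prime] (h5 : 5 ≤ p) (hk : k ≠ 0)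
    (hkp : k ≤ p) (hpm : ¬ p ∣ m) {v Λ ℓ : ℂ}
    (hΛ : Λ = I ^ ((k + 1 : ℕ) : ℤ) * v) (hℓ : ℓ = Λ * (Real.sqrt (2 * ((24 * m ^ 2) ^ 2 : ℕ)) : ℂ))
    (hE : (((2 * π) ^ ((((k + 1 : ℕ) : ℤ) : ℝ) - 1 / 2) / Real.Gamma ((((k + 1 : ℕ) : ℤ) : ℝ) - 1 / 2) : ℝ) : ℂ) * ℓ =
      (-1 : ℂ) ^ (k / 2) * ((k - 1)! : ℂ) / 2 ^ (k - 1) / (π : ℂ) ^ k *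
        ((if 2 ∣ m then 1 / 8 else 1 / 4) * (if 3 ∣ m then 1 else 2 / 3) *
          ∏ q ∈ m.primeFactors.erase 2, (((q : ℂ) - 1) / (2 * q))) *
        LSeries (fun N ↦ if N.Coprime m then (1 : ℂ) else 0) (2 * k) * (m : ℂ) ^ (-1 : ℂ)) :
    ∃ u : ℚ, u ≠ 0 ∧ padicValRat p u = 0 ∧
      v ^ 2 = ((u * (bernoulli (2 * k) / (k.factorial : ℚ) * (m : ℚ) ^ (k - 1) *
        ∏ q ∈ m.primeFactors, ((q : ℚ) - 1) * ((q : ℚ) ^ (2 * k) - 1) / (q : ℚ) ^ (2 * k + 1)) ^ 2 : ℚ) : ℂ) := by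
  rw [I_zpow_natCast_succ] at hΛ
  rw [weight_cast_sub_half] at hE
  have ht : 0 < (24 * m ^ 2) ^ 2 := by
    have hm : m ≠ 0 := fun h ↦ hpm (h ▸ dvd_zero p)
    positivity
  exact exists_cuspUnit_sq_eq_of_sockets_announced h5 hk hkp hpm (not_dvd_sq_twentyfour_mul_sq hp.out h5 hpm) ht hΛ hℓ hE

/-! ### §3. The analytic half of conjunct (iii) in one call -/

/-- **THE ANALYTIC HALF OF (iii), abstract prefactor.** For a prime `p ≠ 2`, `k ≥ 1`, `p ∤ m`, `p ∤ t`, a rational `p`-adic unit `a`: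
if the weight-`(k+1)` vehicle `F` factors on the imaginary axis as `F(iy) = (Σ_n a(n)e^{−2πny})·θ_t(iy)` near `0⁺`, Lemma A's limit
`y^{k+1}F(iy) → i^{k+1}·v` holds, `L(a,s)` converges absolutely for real `s > k+½`, and (E3) `(s−(k+½))·L(a,s) → (a·∏_{q∣m,q≠2}(q−1)/(2q))
·π^{−k}·L(𝟙_{⊥m}, 2k)` as `s → (k+½)⁺`, then `v² = u·C²` for a rational `p`-adic unit `u` and the REGISTERED cusp constant `C`.
Chain: (α) `tendsto_rpow_smul_tsum_of_eq_mul_thetaMul` ∘ (E4) `CuspSeed.tendsto_sub_mul_LSeries_of_tendsto_rpow_smul_tsum` ∘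
`tendsto_nhds_unique` ∘ `exists_cuspUnit_sq_eq_of_sockets`. [folklore] -/
theorem exists_cuspUnit_sq_eq_of_limits {p k m t : ℕ} [hp : Fact p.Prime] (hp2 : p ≠ 2) (hk : k ≠ 0)
    (hpm : ¬ p ∣ m) (hpt : ¬ p ∣ t) (ht : 0 < t) {F : ℍ → ℂ} {a : ℕ → ℂ} {v : ℂ} {b : ℚ} (hb0 : b ≠ 0)
    (hb : padicValRat p b = 0)
    (hF : ∀ᶠ y : ℝ in 𝓝[>] (0 : ℝ), F (ofComplex (I * y)) =
      (∑' n : ℕ, a n * (Real.exp (-(2 * π * n * y)) : ℂ)) * thetaMul t (ofComplex (I * y)))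
    (hA : Tendsto (fun y : ℝ => (y : ℂ) ^ ((k + 1 : ℕ) : ℤ) * F (ofComplex (I * y))) (𝓝[>] (0 : ℝ))
      (𝓝 (I ^ ((k + 1 : ℕ) : ℤ) * v)))
    (hsum : ∀ s : ℝ, (k : ℝ) + 1 / 2 < s → LSeriesSummable a s)
    (hE3 : Tendsto (fun s : ℝ ↦ ((s - ((k : ℝ) + 1 / 2) : ℝ) : ℂ) * LSeries a s) (𝓝[>] ((k : ℝ) + 1 / 2))
      (𝓝 (((b : ℂ) * ∏ q ∈ m.primeFactors.erase 2, (((q : ℂ) - 1) / (2 * q))) / (π : ℂ) ^ k *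
        LSeries (fun N ↦ if N.Coprime m then (1 : ℂ) else 0) (2 * k)))) :
    ∃ u : ℚ, u ≠ 0 ∧ padicValRat p u = 0 ∧
      v ^ 2 = ((u * (bernoulli (2 * k) / (k.factorial : ℚ) * (m : ℚ) ^ (k - 1) *
        ∏ q ∈ m.primeFactors, ((q : ℚ) - 1) * ((q : ℚ) ^ (2 * k) - 1) / (q : ℚ) ^ (2 * k + 1)) ^ 2 : ℚ) : ℂ) := by
  -- name the two limits
  set Λ : ℂ := I ^ ((k + 1 : ℕ) : ℤ) * v with hΛdef
  have hΛ : Λ = I ^ (k + 1) * v := by rw [hΛdef, I_zpow_natCast_succ]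
  set ℓ : ℂ := Λ * (Real.sqrt (2 * t) : ℂ) with hℓdef
  -- (α): the quotient by the theta factor
  have hα := tendsto_rpow_smul_tsum_of_eq_mul_thetaMul ht hF hA
  simp only [weight_cast_sub_half] at hα
  -- (E4): Abel limit ⟹ normalised residue
  have hw : (0 : ℝ) < (k : ℝ) + 1 / 2 := by positivity
  have hE4 := CuspSeed.tendsto_sub_mul_LSeries_of_tendsto_rpow_smul_tsum hw hsum hα
  -- (E4) = (E3)
  have hE := tendsto_nhds_unique hE4 hE3
  exact exists_cuspUnit_sq_eq_of_sockets hp2 hk hpm hpt ht hb0 hb hΛ hℓdef hE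

/-- **THE ANALYTIC HALF OF (iii), announced `R`, vehicle parameters** (`t = (24m²)²`, prime `p ≥ 5`, `1 ≤ k ≤ p`, `p ∤ m`): as
`exists_cuspUnit_sq_eq_of_limits` with the (E3) limit in w5 g6's announced spelling
`(−1)^{⌊k/2⌋}(k−1)!/2^{k−1}/π^k·(c₂·c₃·∏_{q∣m,q≠2}(q−1)/(2q))·L(𝟙_{⊥m}, 2k)·m⁻¹`. [folklore] -/
theorem exists_cuspUnit_sq_eq_of_limits_announced {p k m : ℕ} [hp : Fact p.Prime] (h5 : 5 ≤ p) (hk : k ≠ 0)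
    (hkp : k ≤ p) (hpm : ¬ p ∣ m) {F : ℍ → ℂ} {a : ℕ → ℂ} {v : ℂ}
    (hF : ∀ᶠ y : ℝ in 𝓝[>] (0 : ℝ), F (ofComplex (I * y)) =
      (∑' n : ℕ, a n * (Real.exp (-(2 * π * n * y)) : ℂ)) * thetaMul ((24 * m ^ 2) ^ 2) (ofComplex (I * y)))
    (hA : Tendsto (fun y : ℝ => (y : ℂ) ^ ((k + 1 : ℕ) : ℤ) * F (ofComplex (I * y))) (𝓝[>] (0 : ℝ))
      (𝓝 (I ^ ((k + 1 : ℕ) : ℤ) * v)))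
    (hsum : ∀ s : ℝ, (k : ℝ) + 1 / 2 < s → LSeriesSummable a s)
    (hE3 : Tendsto (fun s : ℝ ↦ ((s - ((k : ℝ) + 1 / 2) : ℝ) : ℂ) * LSeries a s) (𝓝[>] ((k : ℝ) + 1 / 2))
      (𝓝 ((-1 : ℂ) ^ (k / 2) * ((k - 1)! : ℂ) / 2 ^ (k - 1) / (π : ℂ) ^ k *
        ((if 2 ∣ m then 1 / 8 else 1 / 4) * (if 3 ∣ m then 1 else 2 / 3) *
          ∏ q ∈ m.primeFactors.erase 2, (((q : ℂ) - 1) / (2 * q))) *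
        LSeries (fun N ↦ if N.Coprime m then (1 : ℂ) else 0) (2 * k) * (m : ℂ) ^ (-1 : ℂ)))) :
    ∃ u : ℚ, u ≠ 0 ∧ padicValRat p u = 0 ∧
      v ^ 2 = ((u * (bernoulli (2 * k) / (k.factorial : ℚ) * (m : ℚ) ^ (k - 1) *
        ∏ q ∈ m.primeFactors, ((q : ℚ) - 1) * ((q : ℚ) ^ (2 * k) - 1) / (q : ℚ) ^ (2 * k + 1)) ^ 2 : ℚ) : ℂ) := by
  have hm : m ≠ 0 := fun h ↦ hpm (h ▸ dvd_zero p)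
  have ht : 0 < (24 * m ^ 2) ^ 2 := by positivity
  set Λ : ℂ := I ^ ((k + 1 : ℕ) : ℤ) * v with hΛdef
  have hΛ : Λ = I ^ (k + 1) * v := by rw [hΛdef, I_zpow_natCast_succ]
  set ℓ : ℂ := Λ * (Real.sqrt (2 * ((24 * m ^ 2) ^ 2 : ℕ)) : ℂ) with hℓdef
  have hα := tendsto_rpow_smul_tsum_of_eq_mul_thetaMul ht hF hA
  simp only [weight_cast_sub_half] at hα
  have hw : (0 : ℝ) < (k : ℝ) + 1 / 2 := by positivity
  have hE4 := CuspSeed.tendsto_sub_mul_LSeries_of_tendsto_rpow_smul_tsum hw hsum hα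
  have hE := tendsto_nhds_unique hE4 hE3
  exact exists_cuspUnit_sq_eq_of_sockets_announced h5 hk hkp hpm (not_dvd_sq_twentyfour_mul_sq hp.out h5 hpm) ht
    hΛ hℓdef hE

end Summit.BirchSwinnertonDyer.BirchSwinnertonDyer.Theorems.PrintCFram.CuspGlue
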